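import Summits.RiemannHypothesis.RiemannHypothesis.Theorems.PfPersistenceM2ThreeLaws
import HarnessLib

/-!
# PfPersistence (M2 seat, gen 4) — the gap law as NAMED Props (`IsGapConstant`, `GapLaw`)

Cell `pub-rhpf`, seat M2; HOME/M2-ROUTE.md §§2–4, §10; answers ADJ-LOG A21 (M2-G2 RETURN: "no Lean Prop is named
although the typed shape exists verbatim as the binders `hgap`, `hG` of `m2_asymptotic_of_three_laws`").
HONEST FRAMING: long-odds MECHANISM SEARCH; no RH claims.  This file only NAMES two hypotheses of the gen-2
theorem `PfPersistenceM2Laws.m2_asymptotic_of_three_laws` and repackages it; nothing is asserted.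

* `IsGapConstant δ u a₀` (HYPOTHESIS shape, = binder `hgap`): on every window `a ≥ a₀`, `δ a` is a variational
  gap constant of Weil's form in the direction `u a`:
  `δ a · (‖f‖² − |⟨f, u a⟩|²) ≤ Re Q(f) − ε(a) ‖f‖²` for every Weil test `f` supported in `[-a, a]`
  (`ε = weilGroundEnergy`, the FULL ground energy; all tests, not only even ones).
* `GapLaw c_G B_G a₀ δ` (HYPOTHESIS shape, = binders `hcG`, `hG`): `c_G > 0` and
  `c_G μ^{B_G} e^{−4πμ} ≤ δ a` for `a ≥ a₀`, `μ = e^{2a}` (Connes-type law for the gap `ε₂ − ε₁`; DATA label for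
  the exponent: M2-DATA.md D1–D2 give `B_G ≈ B_U + 4.4`).
* `m2_asymptotic_of_gapLaw`: `IsGapConstant` + `GapLaw` + (UPPER witness) + (FLOOR) + `B_U < B_G` ⇒ M2 along
  `a → ∞` — literally `m2_asymptotic_of_three_laws`.
* `gapLaw_pos`, `isGapConstant_orthogonal`: the two elementary RH-free readings (the law makes `δ a > 0`; on the
  orthocomplement of `u a` the form is `≥ (ε(a) + δ a)‖f‖²`).

STRENGTH (HEURISTIC label, unchanged; see M2-ROUTE §10 for what gen 4 adds): `GapLaw` for the FULL form is not
known to be RH-strength nor RH-free; in the EVEN REAL sector the negative index is at most the number of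
off-line quadruples (`PfPersistenceM2NegIndex.exists_combination_re_weilQuadratic_nonneg`, Bombieri 2000 Thm 9),
so there "second even level `≥ 0` on all windows" follows from "at most one off-line quadruple".
-/

noncomputable section

set_option linter.dupNamespace false  -- the mandated namespace repeats `RiemannHypothesis`

open Set MeasureTheory Filter Complex
open scoped Real Topology ComplexConjugate

namespace Summit.RiemannHypothesis.RiemannHypothesis.Theorems.PfPersistenceM2Laws

open Literature.NumberTheory.LFunctions

/-! ## The two named hypothesis shapes -/

/-- **HYPOTHESIS shape (GAP CONSTANT in the direction `u a`)** — binder `hgap` of `m2_asymptotic_of_three_laws`,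
verbatim: for all windows `a ≥ a₀` and every Weil test `f` supported in `[-a, a]`,
`δ a · (‖f‖₂² − |⟨f, u a⟩|²) ≤ Re Q(f) − ε(a) ‖f‖₂²`.  Nowhere asserted. -/
def IsGapConstant (δ : ℝ → ℝ) (u : ℝ → ℝ → ℂ) (a₀ : ℝ) : Prop :=
  ∀ a : ℝ, a₀ ≤ a → ∀ f : ℝ → ℂ, IsWeilTest f → tsupport f ⊆ Icc (-a) a →
    δ a * ((∫ t, ‖f t‖ ^ 2) - ‖∫ t, f t * conj (u a t)‖ ^ 2) ≤
      (weilQuadratic f).re - weilGroundEnergy a * ∫ t, ‖f t‖ ^ 2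

/-- **HYPOTHESIS shape (GAP LAW with constant `c_G` and exponent `B_G`)** — binders `hcG`, `hG` of
`m2_asymptotic_of_three_laws`: `0 < c_G` and `c_G μ^{B_G} e^{−4πμ} ≤ δ a` for all `a ≥ a₀`, `μ = e^{2a}`.
Nowhere asserted; its strength is open (HEURISTIC discussion in HOME/M2-ROUTE.md §7.3/§10). -/
def GapLaw (c_G B_G a₀ : ℝ) (δ : ℝ → ℝ) : Prop :=
  0 < c_G ∧ ∀ a : ℝ, a₀ ≤ a →
    c_G * Real.exp (2 * a) ^ B_G * Real.exp (-(4 * π * Real.exp (2 * a))) ≤ δ a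

/-! ## Elementary RH-free readings -/

/-- Under the gap law the gap constant is positive on every window `a ≥ a₀`. [folklore] -/
theorem gapLaw_pos {c_G B_G a₀ : ℝ} {δ : ℝ → ℝ} (h : GapLaw c_G B_G a₀ δ) {a : ℝ} (ha : a₀ ≤ a) :
    0 < δ a := by
  obtain ⟨hc, hG⟩ := h
  have hμ : 0 < Real.exp (2 * a) ^ B_G := Real.rpow_pos_of_pos (Real.exp_pos _) _
  exact lt_of_lt_of_le (by positivity) (hG a ha)

/-- On the orthocomplement of the direction `u a` a gap constant bounds the form from below by
`(ε(a) + δ a) ‖f‖₂²`. [folklore] -/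
theorem isGapConstant_orthogonal {δ : ℝ → ℝ} {u : ℝ → ℝ → ℂ} {a₀ : ℝ} (h : IsGapConstant δ u a₀)
    {a : ℝ} (ha : a₀ ≤ a) {f : ℝ → ℂ} (hf : IsWeilTest f) (hfs : tsupport f ⊆ Icc (-a) a)
    (horth : ∫ t, f t * conj (u a t) = 0) :
    (weilGroundEnergy a + δ a) * ∫ t, ‖f t‖ ^ 2 ≤ (weilQuadratic f).re := by
  have h1 := h a ha f hf hfs
  rw [horth, norm_zero, zero_pow two_ne_zero, sub_zero] at h1
  linarith

/-! ## The repackaged M2 theorem -/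

/-- **Asymptotic M2 from the named laws** (= `m2_asymptotic_of_three_laws` with `hgap ↦ IsGapConstant`,
`hcG ∧ hG ↦ GapLaw`): HYPOTHESES `IsGapConstant δ u a₀`, `GapLaw c_G B_G a₀ δ`, an (UPPER) normalised window
witness `p a` with `Re Q(p a) ≤ C_U μ^{B_U} e^{−4πμ}`, the (FLOOR) `−σ μ^{B_U} e^{−4πμ} ≤ ε(a)` (RH-strength:
`riemannHypothesis_of_lawFloor`), and `B_U < B_G`.  CONCLUSION: `1 − |⟨p a, u a⟩|² ≤ θ` on all large windows,
every `θ > 0`. [folklore] -/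
theorem m2_asymptotic_of_gapLaw {B_U B_G C_U c_G σ a₀ : ℝ} {u p : ℝ → ℝ → ℂ} {δ : ℝ → ℝ}
    (hgap : IsGapConstant δ u a₀) (hlaw : GapLaw c_G B_G a₀ δ)
    (hp : ∀ a : ℝ, a₀ ≤ a →
      IsWeilTest (p a) ∧ tsupport (p a) ⊆ Icc (-a) a ∧ ∫ t, ‖p a t‖ ^ 2 = (1 : ℝ))
    (hU : ∀ a : ℝ, a₀ ≤ a →
      (weilQuadratic (p a)).re ≤ C_U * Real.exp (2 * a) ^ B_U * Real.exp (-(4 * π * Real.exp (2 * a))))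
    (hfloor : ∀ a : ℝ, a₀ ≤ a →
      -(σ * Real.exp (2 * a) ^ B_U * Real.exp (-(4 * π * Real.exp (2 * a)))) ≤ weilGroundEnergy a)
    (hB : B_U < B_G) {θ : ℝ} (hθ : 0 < θ) :
    ∃ a₁ : ℝ, ∀ a : ℝ, a₁ ≤ a → 1 - ‖∫ t, p a t * conj (u a t)‖ ^ 2 ≤ θ :=
  m2_asymptotic_of_three_laws hgap hlaw.2 hlaw.1 hp hU hfloor hB hθ

end Summit.RiemannHypothesis.RiemannHypothesis.Theorems.PfPersistenceM2Laws

end
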